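/-
Copyright (c) 2026. All rights reserved.
Released under Apache 2.0 license as described in the file LICENSE.
Authors: abc-iut cell, statement-typer seat abc-iut-L4-t3 (wave 1); `⋉`-twin re-elaborated by prover seat abc-iut-L4-t11
(gen 15) per the cell recipe LTIMES-RECIPE (owner abc-iut-L4-t3), statements unchanged.
-/
import Mathlib.Combinatorics.Quiver.Cast
import Literature.AnabelianGeometry.AbsoluteAnabelian.DiagramMorphisms
import Literature.AnabelianGeometry.AbsoluteAnabelian.Ltimes.LogFrobeniusCorollaries
import Literature.AnabelianGeometry.AbsoluteAnabelian.LogFrobeniusRigidity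
import HarnessLib

/-!
# [AbsTopIII] Corollary 5.5 (v): the nexus `□`, total `□`-rigidity and the `ℤ`-action on `D•`

S. Mochizuki, *Topics in absolute anabelian geometry III: global reconstruction algorithms*,
J. Math. Sci. Univ. Tokyo 22 (2015) 939–1156 [MochizukiAbsTopIII2015]; locators `p.N` = pages of the
author's manuscript (`paper:url-5493eb38cbb7`; journal pagination not held), read on the page: Cor 5.5 (v)
pp. 131–132 (proof p. 133), (vi) p. 132; Cor 5.10 preamble pp. 146–147 (`•`-shell-containers), (iii) p. 147;
Def 3.5 (v), (vi) pp. 76–77 and §0 p. 27 for the notions used (`DiagramMorphisms.lean`, seat abc-iut-L4-t2).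

Continuation of `LogFrobeniusCorollaries.lean` (Cor 5.5 (i)–(iv), Cor 5.10 (iv)(a)–(c)) over a `LogFrobeniusSetting L`
and its realised diagram of categories `L.diagram` (= `D•⊢`, whose rows 1–7 form `D•`; shape `DVertex`/`DEdge`):
* Cor 5.5 (v): "`□` is a nexus of `Γ⃗_{D•}`" — PROVED (`DVertex.core_isNexus`; the vertices of `D⊢` lie in the
  post-nexus portion, so the statements for `D•` and `D•⊢` coincide; `core_isNexus_sub` for `D•_{≤m}`, `m ≥ 5`, e.g.
  `D• = D•_{≤7}`); "`D•` is totally `□`-rigid" = `Cor55CoreRigid`, REDUCED (`cor55CoreRigid_iff`, proved) to the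
  id-rigidity of the one category `𝒳 = Th•_T[Z]`, which is what the printed proof supplies (p. 133: `Th⊚_T ≃ EA⊚` and
  slimness for `• = ⊚`, elimination of the automorphisms of the orbi-objects of a panalocal Galois-theater for `• = ✠`);
  the `ℤ`-action: the shift `⋎ ↦ ⋎ + k` is CONSTRUCTED as a morphism of oriented graphs `DVertex.shiftGraph k` and as a
  1-morphism `L.shiftOneMorphism k` of `D•⊢` over it (identity functors at every vertex, as in the extension procedure
  of Def 3.5 (vi)); that such a 1-morphism, once an equivalence, is a nexus self-equivalence relative to `□` is PROVED
  (`shift_isNexusClass`); the assertion proper = `Cor55ShiftAction`;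
* Cor 5.5 (vi) (the panalocalization morphism `D⊚ → D✠`) and Cor 5.10 (iii) are the next file,
  `LogFrobeniusPanalocalization.lean`, over the shifts constructed here.

Every `Prop` below is an ASSUMPTION on the interface datum `L` which the text asserts for the genuine Galois-theaters
of an elliptically admissible `Z`. NOT here: the extension of the shifts to the telecore DIAGRAM `D_{An•}` of Cor 5.5
(ii) compatibly with its families `𝔍`, `ℋ_{An•}` (by identity functors again; TODO(general form)); the `TS`-valued
observable `S_log` and the second sentence of Cor 5.5 (iv) stay as recorded in `LogFrobeniusCorollaries.lean`.
Refereed pre-IUT material; nothing here bears on [IUTchIII] Cor. 3.12; typed ≠ discharged.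

**`⋉`-TWIN (cell row «LTIMES-SUCCESSOR», L4-lead m162; typing finding T3g9-F1).**  This file is the verbatim
re-elaboration of `LogFrobeniusRigidity.lean` over the successor interface `LogFrobeniusSettingLtimes`
(`Ltimes/LogFrobeniusCompatibility.lean`: `ι⊞_{v,ε}` indexed by the edges of `Γ⃗^⋉_v` at EVERY place, [AbsTopIII] Cor 5.5 (iii)
p. 131), produced by the cell recipe `LTIMES-RECIPE.md`: names carry over inside `namespace LogFrobeniusSettingLtimes`, the
section variable is `Lt`, setting-independent declarations are NOT repeated (the originals are in scope), statements and
proofs are otherwise unchanged.  The original file over the frozen interface stays as it is.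
-/

set_option autoImplicit false

universe u

open CategoryTheory Quiver

namespace Literature.AnabelianGeometry.AbsoluteAnabelian

variable {Vmod : Type u} {isArc : Vmod → Bool}

/-! ## Corollary 5.5 (v): the setting-independent part (`DVertex.rowOne`, `DVertex.core_isNexus`,
`DVertex.core_isNexus_sub`, `DVertex.shiftHom`, `DVertex.shiftGraph`) is the ORIGINAL file's (imported, not repeated). -/

/-- transporting an arrow along equalities of its end-vertices does not change the functor it realises.
[cite: MochizukiAbsTopIII2015, Cor 5.5 p. 129] -/
theorem DEdge.functorLtimes_cast (Lt : LogFrobeniusSettingLtimes Vmod isArc) {a a' b b' : DVertex Vmod isArc} (ha : a = a')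
    (hb : b = b') (e : a ⟶ b) : HEq (DEdge.functorLtimes Lt (e.cast ha hb)) (DEdge.functorLtimes Lt e) := by
  subst ha hb; rfl

namespace LogFrobeniusSettingLtimes

variable (Lt : LogFrobeniusSettingLtimes Vmod isArc)

/-! ## Corollary 5.5 (v), second clause: total `□`-rigidity -/

/-- **Cor 5.5 (v), second clause** (assumption on `L`): "`D•` is totally `□`-rigid" — Def 3.5 (vi): the pre-nexus
portion `D•_{≤□}` (the copies `𝒳_⋎`, `⋎ ∈ L`, and `□`, with the arrows `log`, `id_⋎`) is totally rigid (every vertex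
category id-rigid, every edge functor rigid). [cite: MochizukiAbsTopIII2015, Cor 5.5 (v) p. 131] -/
def Cor55CoreRigid : Prop :=
  Lt.diagram.IsTotallyNexusRigid DVertex.core DVertex.rowOne

/-- REDUCTION of the second clause of Cor 5.5 (v) to its printed proof (p. 133): `D•` is totally `□`-rigid iff the
single category `𝒳 = Th•_T[Z]` is id-rigid (all vertices of `D•_{≤□}` carry `𝒳`; the edge functors `log ≅ id` and
`id` are then rigid; `□` is a nexus unconditionally). [cite: MochizukiAbsTopIII2015, Cor 5.5 (v) p. 133] -/
theorem cor55CoreRigid_iff : Lt.Cor55CoreRigid ↔ IsIdRigid Lt.X := by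
  constructor
  · rintro ⟨-, hV, -⟩
    exact hV ⟨.core, Or.inr rfl⟩
  · intro h
    refine ⟨DVertex.core_isNexus, ?_, ?_⟩
    · rintro ⟨a, (⟨k, rfl⟩ | ha)⟩
      · exact h
      · obtain rfl : a = .core := ha
        exact h
    · rintro ⟨a, ha⟩ ⟨b, hb⟩ e
      rcases ha with ⟨k, rfl⟩ | ha
      · cases e
        · show IsRigidFunctor Lt.log
          intro α
          have hβ := h (Lt.logIsoId.symm ≪≫ α ≪≫ Lt.logIsoId)
          calc α = Lt.logIsoId ≪≫ (Lt.logIsoId.symm ≪≫ α ≪≫ Lt.logIsoId) ≪≫ Lt.logIsoId.symm := by simp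
            _ = Iso.refl _ := by rw [hβ]; simp
        · exact h
      · obtain rfl : a = .core := ha
        cases e
        exact absurd hb (by rintro (⟨k, hk⟩ | hk) <;> cases hk)

/-! ## Corollary 5.5 (v), third clause: the shifts as 1-morphisms of `D•⊢`; the `ℤ`-action -/

/-- the functor of the shift at a vertex: the IDENTITY functor `𝒟_x ⥤ 𝒟_{x + k}` (the categories at `𝒳_⋎` and
`𝒳_{⋎+k}` are the same category `Th•_T[Z]`; every other vertex is fixed). [cite: MochizukiAbsTopIII2015, Cor 5.5 (v) p. 132] -/
def shiftApp (k : ℤ) : (x : DVertex Vmod isArc) → (x.categoryLtimes Lt ⥤ (x.shift k).categoryLtimes Lt)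
  | .row1 _ => 𝟭 Lt.X
  | .core => 𝟭 Lt.X
  | .nplus v => 𝟭 (Lt.Nplus v)
  | .nv v => 𝟭 (Lt.N v)
  | .e5 => 𝟭 Lt.E
  | .an => 𝟭 Lt.An
  | .e7 => 𝟭 Lt.E
  | .nmonoPlus w => 𝟭 (Lt.NmonoPlus w)
  | .nmono w => 𝟭 (Lt.Nmono w)
  | .emono5 => 𝟭 Lt.Emono
  | .anMono => 𝟭 Lt.AnMono
  | .emono7 => 𝟭 Lt.Emono

-- `shiftHom_log` is setting-independent: the original (namespace `LogFrobeniusSetting`) is re-exposed here.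
export LogFrobeniusSetting (shiftHom_log)

/-- the shifted `log` arrow realises `log`. [cite: MochizukiAbsTopIII2015, Cor 5.5 (v) p. 132] -/
theorem functor_shiftHom_log (k n : ℤ) :
    DEdge.functorLtimes Lt (DVertex.shiftHom k (DEdge.log (isArc := isArc) n)) = Lt.log := by
  rw [shiftHom_log]
  exact eq_of_heq (DEdge.functorLtimes_cast Lt _ _ _)

/-- the shift commutes (strictly) with the functors of `D•⊢`. [cite: MochizukiAbsTopIII2015, Cor 5.5 (v) p. 132] -/
theorem shift_comm (k : ℤ) {a b : DVertex Vmod isArc} (e : a ⟶ b) :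
    Lt.shiftApp k a ⋙ DEdge.functorLtimes Lt (DVertex.shiftHom k e) = DEdge.functorLtimes Lt e ⋙ Lt.shiftApp k b := by
  cases e <;> first | rfl | (rw [functor_shiftHom_log]; rfl)

/-- the shift by `k` as a 1-morphism of diagrams of categories `D•⊢ → D•⊢` (Def 3.5 (v)) over `shiftGraph k`: identity
functors at the vertices, identity (up to the strict commutation `shift_comm`) 2-cells at the arrows — the
"natural extension" of Def 3.5 (vi) of the shift of `D•_{≤□}`. [cite: MochizukiAbsTopIII2015, Cor 5.5 (v) p. 132] -/
def shiftOneMorphism (k : ℤ) :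
    DiagramOfCategories.OneMorphism (DVertex.shiftGraph k) Lt.diagram Lt.diagram where
  app := Lt.shiftApp k
  iso e := eqToIso (Lt.shift_comm k e)

/-- PROVED: a shift 1-morphism that is an equivalence of diagrams is a NEXUS self-equivalence of `D•⊢` relative to
`□` in the sense of Def 3.5 (vi) (identity on the post-nexus portion, identity functor at `□`, preserving the
pre-nexus portion). [cite: MochizukiAbsTopIII2015, Cor 5.5 (v) p. 132] -/
theorem shift_isNexusClass (k : ℤ) (h : (Lt.shiftOneMorphism k).IsEquivalence) :
    (⟨DVertex.shiftGraph k, Lt.shiftOneMorphism k, h⟩ : Lt.diagram.SelfEquivalence).IsNexusClass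
      .core DVertex.rowOne where
  isNexus := DVertex.core_isNexus
  maps_pre := by rintro a ⟨m, rfl⟩; exact ⟨m + k, rfl⟩
  obj_eq_of_not_mem := by
    intro a ha
    cases a <;> first | rfl | exact (ha ⟨_, rfl⟩).elim
  map_heq_of_not_mem := by
    intro a b e ha _
    cases e <;> first | exact HEq.rfl | exact (ha ⟨_, rfl⟩).elim
  app_heq_id := by
    intro a _ _
    cases a <;> exact HEq.rfl
  obj_nexus := rfl
  app_nexus_iso_id := ⟨𝟭 Lt.X, HEq.rfl, ⟨Iso.refl _⟩⟩

/-- a core structure of `D_{≤P} ∪ {x}` on `D_{≤P}` (as in `IsCoreOn`, Cor 5.5 (i)) whose family of homotopies EMBEDS into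
the family `K` on `D•⊢` (`CompatibleIn`). [cite: MochizukiAbsTopIII2015, Cor 5.5 (i) p. 130] -/
def IsCoreOnIn (K : Lt.diagram.HomotopyFamily) (P : DVertex Vmod isArc → Prop) (x : DVertex Vmod isArc) : Prop :=
  ∃ (H : ((Lt.subdiagram P).extend (Lt.obsExt P x)).HomotopyFamily)
    (hH : ∀ ⦃a b : (obsShape P x).Vertex⦄ ⦃p q : Path a b⦄, H.E p q → b = (obsShape P x).obs),
    (DiagramOfCategories.Observable.mk (obsShape P x) (fun _ => (inferInstance : IsEmpty PEmpty.{u + 1}))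
      (Lt.obsExt P x) H hH).IsCore ∧ Lt.CompatibleIn K H

/-- `K` REALISES the cores of Cor 5.5 (i) and the observables `S_log⊞` of Cor 5.5 (iii): witnessing families exist
that all embed into the one family `K` on `D•⊢` (Cor 5.5 (iii): these families "are compatible with one another as
well as with the families of homotopies that constitute the core and telecore structures of (i), (ii)").
[cite: MochizukiAbsTopIII2015, Cor 5.5 (iii) p. 131] -/
def RealisesCor55Families (K : Lt.diagram.HomotopyFamily) : Prop :=
  Lt.IsCoreOnIn K (DVertex.InFirstRows 4) .e5 ∧ Lt.IsCoreOnIn K (DVertex.InFirstRows 5) .an ∧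
    Lt.IsCoreOnIn K (DVertex.InFirstRows 6) .e7 ∧
    ∀ v : Vmod, ∃ H : (Lt.logDiagramPlus v).HomotopyFamily, Lt.IsLogObservablePlus v H ∧ Lt.CompatibleIn K H

/-- **Cor 5.5 (v), third clause** (assumption on `L`): "the natural action of `ℤ` on `Γ⃗_{D•_{≤1}}` extends to an
action of `ℤ` on `D•` by nexus-classes of self-equivalences of `D•`; the self-equivalences in these nexus-classes are
compatible with the families of homotopies that constitute the cores and observables of (i), (iii)" — typed for the
constructed shifts `L.shiftOneMorphism k`: (1) each is an equivalence of diagrams of categories (hence, by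
`shift_isNexusClass`, a nexus self-equivalence); (2) group law: the class of the shift by `0` is that of the identity
1-morphism and the composite of the shifts by `k` and `l` is [2-]isomorphic to the shift by `k + l` (after transport
along the equality of the underlying morphisms of graphs, as in Def 3.5 (v)); (3) each shift is compatible (Def 3.5
(v)) with one family of homotopies on `D•⊢` realising the cores of (i) and the observables of (iii). (The further
extension to the telecore diagram `D_{An•}` of (ii), compatible with `𝔍` and `ℋ_{An•}`, is by identity functors as well;
not typed as a diagram statement — TODO(general form).) [cite: MochizukiAbsTopIII2015, Cor 5.5 (v) pp. 131–132] -/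
def Cor55ShiftAction : Prop :=
  (∀ k : ℤ, (Lt.shiftOneMorphism k).IsEquivalence) ∧
  (∃ h₀ : DVertex.shiftGraph (Vmod := Vmod) (isArc := isArc) 0 = 𝟭q (DVertex Vmod isArc),
      (h₀ ▸ Lt.shiftOneMorphism 0).Isomorphic (DiagramOfCategories.OneMorphism.id Lt.diagram)) ∧
  (∀ k l : ℤ, ∃ h : DVertex.shiftGraph (Vmod := Vmod) (isArc := isArc) k ⋙q DVertex.shiftGraph l =
      DVertex.shiftGraph (k + l),
      (h ▸ (Lt.shiftOneMorphism k).comp (Lt.shiftOneMorphism l)).Isomorphic (Lt.shiftOneMorphism (k + l))) ∧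
  (∃ K : Lt.diagram.HomotopyFamily, Lt.RealisesCor55Families K ∧
      ∀ k : ℤ, Nonempty ((Lt.shiftOneMorphism k).CompatibleWith K K))

/-- **Cor 5.5 (v)** as one node: total `□`-rigidity and the `ℤ`-action by nexus-classes (the nexus clause being the
theorem `DVertex.core_isNexus`). [cite: MochizukiAbsTopIII2015, Cor 5.5 (v) pp. 131–132] -/
def Cor55Rigidity : Prop := Lt.Cor55CoreRigid ∧ Lt.Cor55ShiftAction

end LogFrobeniusSettingLtimes

end Literature.AnabelianGeometry.AbsoluteAnabelian
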